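import Literature.MathematicalPhysics.StatisticalMechanics.EIPSliceRecursion
import Literature.MathematicalPhysics.StatisticalMechanics.GridCubicles
import Mathlib.Analysis.SpecialFunctions.Pow.Real
import HarnessLib

/-!
# The edge-isoperimetric theorem in `ℤ^d` with nested solutions (Agnarsson–Lauria 2013, §5–§6) —
# part II; discharge of `MaininiSchmidt2020_cor33`

Topic `Literature/MathematicalPhysics/StatisticalMechanics`; concludes the series
`EIPMinimizerSections` → `EIPSliceRecursion` (geometry: slicing, stacks of nested minimizers, the
section inequality) and `GridCubicles` (arithmetic: pseudo-cubic representations `n = [m,ℓ]^d + n'`,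
the cubicle cost `cubicleCost d n = 2δ_d(n)` and the cubicle slice profiles).  Everything here is
PROVED; no named facts are introduced, and the vendored fact
`EdgeIsoperimetricFluctuations.MaininiSchmidt2020_cor33` ([MS20] Corollary 3.3: axis-parallel sections
of `EIP^{d}` minimizers are `EIP^{d−1}` minimizers, every `d`) is DISCHARGED
(`MaininiSchmidt2020_cor33_holds`).

## The printed proof and how it is followed

[AL13] prove `max #{induced edges of an n-subset of ℤ^d} = F_d(n) := Σ_i (d+1−i) g_i(n)` (Theorem 6.4)
by induction on `d + n`, and that the cubicles `⟦n⟧^d` (nested in `n`, Proposition 5.7) are optimal.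
In boundary form (`#Θ_d(A) = 2d·#A − 2·#edges(A)`) their quantities are our `eipValue d n` (`E`) and
`cubicleCost d n` (`F`, i.e. `2δ_d(n)`), and the proof has an arithmetic and a geometric half.

* ARITHMETIC (sections `KeyArith`, `Statements`, `Key`, `PStep`; pure `ℕ`, continuing `GridCubicles`).
  `CubicleP d` is [AL13]'s statement `P(d, ·)` (§5: completing a pseudo-cube `C = [m,ℓ]^d` from two
  cubicles `n₁, n₂ ≤ C ≤ n₁ + n₂` does not increase the cost) and `CubicleKey d` is the inequality of
  §6 (`F_d(n) ≥ F_d(n₁) + F_{d−1}(n₂) + n₂` for `n₂ ≤ n/(m_d+1)`, boundary form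
  `cubicleCost d N ≤ cubicleCost d (N − n₂) + cubicleCost (d−1) n₂`).  `cubicleKey_succ_succ` is §6
  verbatim (First case: subadditivity of `F_{d−1}` on the remainders; Second case: reduction to
  `P(d−1)` (eq. (2leq2)) or to the key inequality one dimension down (eq. (n₁'n₂''))), and
  `cubicleP_succ_succ` is §5's `P'(d) ⇒ P(d)` together with the implication (1st-impl)
  (`cubicleP'_succ_succ`), whose geometric inputs — "`E_{d−1}` is super-additive", "put `n''` points on
  one side of the box", "`E_{d−1}(n'') ≤ E_d(n'')`" — enter as the hypotheses `CubicleSubadd`,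
  `CubicleReal`, `CubicleMono` on the cost function, discharged in the geometric half.
* GEOMETRY (sections `Subadd`, `Realize`, `Main`).  `eipValue_add_le` (two minimizers far apart),
  `eipValue_succ_mul_add_le` / `eipValue_succ_le_two_mul_add` (stacks over a nested family,
  `EIPSliceRecursion.eipValue_succ_le_profileCost`), the cube bound `boxPerim_zero_le_eipValue_pow`
  (the sharp Loomis–Whitney inequality `LoomisWhitney.two_mul_card_mul_rpow_le_card_boundaryPairs`,
  replacing [AL13] Proposition 3.2 / Corollary 4.3 for `d`-th powers), the upper bound
  `eipValue_le_cubicleCost_succ` (the cubicle as a stack of nested `(d−1)`-minimizers with profile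
  `cubicleSlices`, Observation 5.12), and the lower bound `cubicleCost_le_eipValue_succ` — Theorem 6.4's
  induction on `n`: for a non-cube `N` a minimizer has, along some axis, at least `m_d + 1` non-empty
  sections (`EIPSliceRecursion.exists_latticeSection_card_mul_le`), removing the smallest one costs
  `E_d(N) ≥ E_d(N − k) + E_{d−1}(k)` (Observation 6.1 = `IsEIPMinimizer.eipValue_sub_add_eipValue_le`,
  which uses nested solutions one dimension down), and `CubicleKey` closes.  The induction on the
  dimension `eipValue_eq_cubicleCost_and_nested` carries `E = F`, a nested family of minimizers
  (`isNestedMinimizerFamily_cubicle_succ`: the stacks with the cubicle profiles, Proposition 5.7 (ii),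
  via `EIPSliceRecursion.isNestedMinimizerFamily_famStack_of_chain`), `CubicleP` and `CubicleKey`;
  dimension one is intervals (`EIPMinimizerSections.isNestedMinimizerFamily_intervalConfig`).

Main results: `eipValue_eq_cubicleCost` ([AL13] Theorem 6.4, every `d ≥ 1`),
`isEIPMinimizer_iff_card_boundaryPairs_eq_cubicleCost` (a decidable optimality criterion),
`exists_isNestedMinimizerFamily` (nested solutions in every `ℤ^d`, Ahlswede–Bezrukov = [MS20]
Theorem 2.2 in family form), `cubicleP_all`, `cubicleKey_all`, `cubicleSubadd_all`, and
`MaininiSchmidt2020_cor33_holds`.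

## References

* [AL13] G. Agnarsson, K. Lauria, *Extremal subgraphs of the d-dimensional grid graph*,
  arXiv:1302.6517 (2013), §5 (Definition 5.1 – Observation 5.12), §6 (Observation 6.1 – Theorem 6.4).
  Bib key `AgnarssonLauria2013`.
* [MS20] E. Mainini, B. Schmidt, *Maximal fluctuations around the Wulff shape for edge-isoperimetric
  sets in ℤ^d: a sharp scaling law*, arXiv:2003.01679 (2020), Theorem 2.2, Proposition 3.2,
  Corollary 3.3.  Bib key `MaininiSchmidt2020`.
* [LW49] L. H. Loomis, H. Whitney, *An inequality related to the isoperimetric inequality*,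
  Bull. AMS 55 (1949), Theorem 2.  Bib key `LoomisWhitney1949`.
* R. Ahlswede, S. L. Bezrukov, *Edge isoperimetric theorems for integer point arrays*, Appl. Math.
  Lett. 8 (1995) 75–80 (the original nested-solutions theorem; not held — acq-12942 — and not cited
  in declarations).
-/

namespace Literature.MathematicalPhysics.StatisticalMechanics

open Finset
open Literature.Probability.LatticeModels


/-! ### Consecutive pseudo-cubics and the position of `n₁` ([AL13] Claim 5.2, Observation 6.2) -/

section KeyArith

variable {d : ℕ}

/-- **No pseudo-cubic lies strictly between `[m,ℓ]^d` and `[m,ℓ+1]^d`**: if `[m,ℓ]^d < [m',ℓ']^d`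
(`ℓ + 1 ≤ d`, `ℓ' ≤ d`) then `[m,ℓ+1]^d ≤ [m',ℓ']^d`. [cite: AgnarssonLauria2013, Claim 5.2 (lexicographic order of pseudo-cubics)] -/
theorem pc_succ_le_of_lt {m ℓ m' ℓ' : ℕ} (hℓ : ℓ + 1 ≤ d) (hℓ' : ℓ' ≤ d)
    (h : pc m ℓ d < pc m' ℓ' d) : pc m (ℓ + 1) d ≤ pc m' ℓ' d := by
  rcases Nat.lt_or_ge m m' with hm | hm
  · exact (pc_le_succ_pow m hℓ).trans ((Nat.pow_le_pow_left hm d).trans (pow_le_pc m' hℓ'))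
  · rcases hm.lt_or_eq with hm | rfl
    · exfalso
      have := pc_le_pc_of_lt ℓ' hm hℓ' ℓ (by omega) (d := d)
      omega
    · by_contra hc
      push Not at hc
      rcases Nat.lt_or_ge ℓ' (ℓ + 1) with h1 | h1
      · have := pc_mono_right m' (show ℓ' ≤ ℓ by omega) (by omega) (d := d)
        omega
      · have := pc_mono_right m' h1 hℓ' (d := d)
        omega

/-- `M < [m,ℓ]^d` (`ℓ ≤ d`) forces `m_d(M) ≤ m` (the top case `ℓ = d` included).
[cite: AgnarssonLauria2013, Observation 5.4] -/
theorem iroot_le_of_lt_pc' (hd : 1 ≤ d) {M m ℓ : ℕ} (hℓ : ℓ ≤ d) (hM : M < pc m ℓ d) :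
    iroot d M ≤ m := by
  have h1 : M < (m + 1) ^ d := lt_of_lt_of_le hM (pc_le_succ_pow m hℓ)
  have h2 := iroot_pow_le hd M
  by_contra hc
  push Not at hc
  have := Nat.pow_le_pow_left (show m + 1 ≤ iroot d M by omega) d
  omega

/-- **[AL13] Observation 6.2 (arithmetic core)**: if `n₂(m+1) ≤ N` where `N = [m,ℓ]^d + n'` is the
PCR of `N`, then `n₁ = N − n₂` is at least the pseudo-cubic preceding `[m,ℓ]^d`:
`[m,ℓ−1]^d ≤ n₁` if `ℓ ≥ 1`. [cite: AgnarssonLauria2013, Observation 6.2] -/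
theorem pc_pred_le_sub {N n₂ m ℓ : ℕ} (hd : 1 ≤ d) (hℓ1 : 1 ≤ ℓ) (hℓ : ℓ ≤ d)
    (hN : pc m ℓ d ≤ N) (h2 : n₂ * (m + 1) ≤ N) : pc m (ℓ - 1) d ≤ N - n₂ := by
  -- `(N − n₂)(m+1) ≥ N m ≥ [m,ℓ]^d m = (m+1) [m,ℓ−1]^d`
  obtain ⟨t, rfl⟩ : ∃ t, ℓ = t + 1 := ⟨ℓ - 1, by omega⟩
  rw [Nat.add_sub_cancel]
  have key : (m + 1) * pc m t d = m * pc m (t + 1) d := by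
    unfold pc
    obtain ⟨r, rfl⟩ : ∃ r, d = t + 1 + r := ⟨d - (t + 1), by omega⟩
    rw [show t + 1 + r - t = r + 1 by omega, show t + 1 + r - (t + 1) = r by omega, pow_succ,
      pow_succ]
    ring
  by_contra hc
  push Not at hc
  -- `(N - n₂) < pc m t d` ⇒ `(m+1)(N − n₂) < (m+1) pc m t d = m pc m (t+1) d ≤ m N`
  have h3 : (m + 1) * (N - n₂) + n₂ * (m + 1) = (m + 1) * N := by
    have : n₂ ≤ N := le_trans (Nat.le_mul_of_pos_right _ (by omega)) h2
    rw [mul_comm n₂, ← Nat.mul_add, Nat.sub_add_cancel this]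
  have h4 : (m + 1) * (N - n₂) < (m + 1) * pc m t d :=
    Nat.mul_lt_mul_of_pos_left hc (by omega)
  have h5 : m * pc m (t + 1) d ≤ m * N := Nat.mul_le_mul_left _ hN
  nlinarith

/-- The `ℓ = 0` companion: if `n₂(m+1) ≤ N`, `m^d ≤ N`, `m ≥ 1`, then `(m−1)·m^{d−1} ≤ N − n₂`
(`[m−1,d−1]^d ≤ n₁`). [cite: AgnarssonLauria2013, Observation 6.2 (the case ℓ_d = 0)] -/
theorem pc_pred_le_sub_zero {N n₂ m : ℕ} (hd : 1 ≤ d) (hm : 1 ≤ m) (hN : m ^ d ≤ N)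
    (h2 : n₂ * (m + 1) ≤ N) : pc (m - 1) (d - 1) d ≤ N - n₂ := by
  obtain ⟨k, rfl⟩ : ∃ k, m = k + 1 := ⟨m - 1, by omega⟩
  obtain ⟨e, rfl⟩ : ∃ e, d = e + 1 := ⟨d - 1, by omega⟩
  simp only [Nat.add_sub_cancel]
  rw [← mul_pc k e le_rfl, pc_self]
  -- goal: k * (k+1)^e ≤ N - n₂; have (k+2) n₂ ≤ N, (k+1)^(e+1) ≤ N
  by_contra hc
  push Not at hc
  have hn₂ : n₂ ≤ N := le_trans (Nat.le_mul_of_pos_right _ (by omega)) h2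
  have h3 : (k + 2) * (N - n₂) + n₂ * (k + 1 + 1) = (k + 2) * N := by
    rw [mul_comm n₂, show k + 1 + 1 = k + 2 by ring, ← Nat.mul_add, Nat.sub_add_cancel hn₂]
  have h4 : (k + 2) * (N - n₂) < (k + 2) * (k * (k + 1) ^ e) :=
    Nat.mul_lt_mul_of_pos_left hc (by omega)
  -- `(k+2) k (k+1)^e = (k² + 2k)(k+1)^e < (k+1)^2 (k+1)^e = (k+1)^(e+2)`? we need ≤ (k+1) N:
  -- `(k+2) k ≤ (k+1)(k+1)` so `(k+2) k (k+1)^e ≤ (k+1)^(e+1) (k+1) ≤ N (k+1)`.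
  have h5 : (k + 2) * (k * (k + 1) ^ e) ≤ (k + 1) * N := by
    calc (k + 2) * (k * (k + 1) ^ e) = ((k + 2) * k) * (k + 1) ^ e := by ring
      _ ≤ ((k + 1) * (k + 1)) * (k + 1) ^ e := Nat.mul_le_mul_right _ (by nlinarith)
      _ = (k + 1) * (k + 1) ^ (e + 1) := by ring
      _ ≤ (k + 1) * N := Nat.mul_le_mul_left _ hN
  nlinarith

end KeyArith

/-! ### The statements carried through the induction ([AL13] §5: P(d,n); §6) -/

section Statements

/-- Subadditivity of the cubicle cost in dimension `d` (true for the optimum `EIP^d` by placing two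
sets far apart; for `cubicleCost` it follows once `cubicleCost d = EIP^d`).
[cite: AgnarssonLauria2013, §5 ("E_{d−1} is super-additive")] -/
def CubicleSubadd (d : ℕ) : Prop := ∀ a b : ℕ, cubicleCost d (a + b) ≤ cubicleCost d a + cubicleCost d b

/-- **[AL13] statement `P(d, ·)`** in boundary form: for a pseudo `d`-cubic `C = [m,ℓ]^d` and
`n₁, n₂ ≤ C ≤ n₁ + n₂`: `Φ_d(C) + Φ_d(n₁ + n₂ − C) ≤ Φ_d(n₁) + Φ_d(n₂)` — completing a pseudo-cube
from two smaller cubicles never increases the total perimeter. [cite: AgnarssonLauria2013, §5 (statement P(d,n))] -/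
def CubicleP (d : ℕ) : Prop :=
  ∀ m ℓ n₁ n₂ : ℕ, 1 ≤ m → ℓ + 1 ≤ d → n₁ ≤ pc m ℓ d → n₂ ≤ pc m ℓ d → pc m ℓ d ≤ n₁ + n₂ →
    cubicleCost d (pc m ℓ d) + cubicleCost d (n₁ + n₂ - pc m ℓ d) ≤ cubicleCost d n₁ + cubicleCost d n₂

/-- **The inequality of [AL13] §6** (their `E_d(n) ≤ F_d(n₁) + F_{d−1}(n₂) + n₂ ≤ F_d(n)` in boundary
form): cutting `n₂ ≤ N/(m_d + 1)` points off `N` costs at least a `(d−1)`-cubicle: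
`Φ_d(N) ≤ Φ_d(N − n₂) + Φ_{d−1}(n₂)`. [cite: AgnarssonLauria2013, §6 (the two cases after Observation 6.2)] -/
def CubicleKey (d : ℕ) : Prop :=
  ∀ N n₂ : ℕ, 1 ≤ n₂ → n₂ * (iroot d N + 1) ≤ N →
    cubicleCost d N ≤ cubicleCost d (N - n₂) + cubicleCost (d - 1) n₂

/-- In dimension one `P` holds (intervals). [cite: AgnarssonLauria2013, §5 ("P(d,n) trivially true whenever d = 1")] -/
theorem cubicleP_one : CubicleP 1 := by
  intro m ℓ n₁ n₂ hm hℓ h1 h2 h12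
  have hℓ0 : ℓ = 0 := by omega
  subst hℓ0
  rw [pc_zero_left, pow_one] at h1 h2 h12 ⊢
  have hv : ∀ x : ℕ, cubicleCost 1 x = if x = 0 then 0 else 2 := fun x => by
    split_ifs with hx
    · rw [hx, cubicleCost_zero]
    · exact cubicleCost_one (Nat.one_le_iff_ne_zero.2 hx)
  rw [hv, hv, hv, hv]
  split_ifs <;> omega

/-- In dimension one the key inequality is vacuous (`n₂ (N + 1) ≤ N` forces `n₂ = 0`).
[cite: AgnarssonLauria2013, §6 (d = 1)] -/
theorem cubicleKey_one : CubicleKey 1 := by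
  intro N n₂ h1 h2
  rw [iroot_one] at h2
  nlinarith

end Statements

/-! ### [AL13] §6: the key inequality in dimension `d` from dimension `d − 1` -/

section Key

variable {d : ℕ}

/-- **[AL13] §6, both cases**: `CubicleKey (d+2)` follows from subadditivity, `P` and the key
inequality in dimension `d + 1`.  Case 1 (`[n₁]_− = [N]_−`): subadditivity of `Φ_{d+1}` on the
remainders.  Case 2 (`[n₁]_−` the preceding pseudo-cubic `Q`, `[m,ℓ]^{d+2} = Q + Δ'`): with
`n₁ = Q + n₁'`, the inequality reduces to `Φ(Δ') + Φ(n') ≤ Φ(n₁') + Φ(n₂)` in dimension `d+1`,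
which is `P(d+1)` when `n₂ ≤ Δ'` and the key inequality in dimension `d+1` for `n'` when
`n₂ = Δ' + n₂''` (`n₂''(m+1) ≤ n'`). [cite: AgnarssonLauria2013, §6 (First case, Second case, eq. (2leq2), (n_1'n_2''))] -/
theorem cubicleKey_succ_succ (d : ℕ) (hS : CubicleSubadd (d + 1)) (hP : CubicleP (d + 1))
    (hK : CubicleKey (d + 1)) : CubicleKey (d + 2) := by
  intro N n₂ hn₂ h2
  have hN : 1 ≤ N := le_trans (le_trans hn₂ (Nat.le_mul_of_pos_right _ (by omega))) h2
  have hn₂N : n₂ ≤ N := le_trans (Nat.le_mul_of_pos_right _ (by omega)) h2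
  -- the PCR of N: name its components
  obtain ⟨m, hm⟩ : ∃ m, iroot (d + 2) N = m := ⟨_, rfl⟩
  obtain ⟨ℓ, hℓ⟩ : ∃ ℓ, plead (d + 2) N = ℓ := ⟨_, rfl⟩
  obtain ⟨n', hn'⟩ : ∃ n', prem (d + 2) N = n' := ⟨_, rfl⟩
  rw [hm] at h2
  have hm1 : 1 ≤ m := hm ▸ iroot_pos (by omega) hN
  have hℓle : ℓ ≤ d + 1 := hℓ ▸ plead_le (d + 2) N
  have hpc : pc m ℓ (d + 2) + n' = N := by
    have := pc_add_prem (d := d + 2) (by omega) N; rwa [hm, hℓ, hn'] at this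
  have hn'lt : n' < pc m ℓ (d + 1) := by
    have := prem_lt_pdelta (d := d + 2) (by omega) N
    rw [hn'] at this; unfold pdelta at this; rwa [hm, hℓ] at this
  have hNlt : N < pc m (ℓ + 1) (d + 2) := by
    have := lt_pc_plead_succ (d := d + 2) (by omega) N; rwa [hm, hℓ] at this
  have hΦN : cubicleCost (d + 2) N = boxPerim m ℓ (d + 2) + cubicleCost (d + 1) n' := by
    rw [cubicleCost_succ_succ d (by omega), hm, hℓ, hn']
  rw [show d + 2 - 1 = d + 1 from rfl]
  by_cases hcase : pc m ℓ (d + 2) ≤ N - n₂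
  · -- Case 1: `n₁` has the same leading pseudo-cubic; subadditivity on the remainders
    have h1 : cubicleCost (d + 2) (N - n₂) =
        boxPerim m ℓ (d + 2) + cubicleCost (d + 1) (N - n₂ - pc m ℓ (d + 2)) :=
      cubicleCost_eq (by omega) hm1 (by omega) hcase (by omega)
    rw [hΦN, h1]
    have h3 : n' = (N - n₂ - pc m ℓ (d + 2)) + n₂ := by omega
    rw [h3]
    have := hS (N - n₂ - pc m ℓ (d + 2)) n₂
    omega
  · push Not at hcase
    rcases Nat.eq_zero_or_pos ℓ with hℓ0 | hℓpos
    · -- Case 2 with ℓ = 0: Q = [m-1, d+1]^{d+2} = (m-1) m^{d+1}, Δ' = m^{d+1}, and n₂ < Δ'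
      subst hℓ0
      have hm2 : 2 ≤ m := by
        by_contra hm2
        have hm1' : m = 1 := by omega
        rw [hm1', pc_succ 1 0 (by omega), pc_zero_left, pc_zero_left, one_pow, one_pow] at hNlt
        rw [hm1'] at h2
        omega
      obtain ⟨k, rfl⟩ : ∃ k, m = k + 1 := ⟨m - 1, by omega⟩
      rw [pc_zero_left] at hpc hcase
      -- Q ≤ n₁
      have hQN : pc k (d + 1) (d + 2) ≤ N - n₂ := by
        have := pc_pred_le_sub_zero (d := d + 2) (by omega) hm1 (by omega) h2
        simpa using this
      have hQsucc : pc k (d + 1 + 1) (d + 2) = (k + 1) ^ (d + 2) := by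
        rw [show d + 1 + 1 = d + 2 from rfl, pc_self]
      have hQΔ : pc k (d + 1) (d + 2) + pc k (d + 1) (d + 1) = (k + 1) ^ (d + 2) := by
        rw [← hQsucc, pc_succ k (d + 1) le_rfl, show d + 2 - 1 = d + 1 from rfl]
      have hΔ : pc k (d + 1) (d + 1) = (k + 1) ^ (d + 1) := pc_self k (d + 1)
      have h1 : cubicleCost (d + 2) (N - n₂) =
          boxPerim k (d + 1) (d + 2) + cubicleCost (d + 1) (N - n₂ - pc k (d + 1) (d + 2)) :=
        cubicleCost_eq (by omega) (by omega) (by omega) hQN (by rw [hQsucc]; exact hcase)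
      have hbox : boxPerim (k + 1) 0 (d + 2) =
          boxPerim k (d + 1) (d + 2) + cubicleCost (d + 1) (pc k (d + 1) (d + 1)) := by
        rw [← boxPerim_self, boxPerim_succ k (d + 1) le_rfl, show d + 2 - 1 = d + 1 from rfl,
          cubicleCost_pc_self (d := d + 1) (by omega)]
      rw [hΦN, h1, hbox]
      -- n₂ ≤ Δ' = (k+1)^{d+1}: from n₂ (k+2) ≤ N < (k+1)^{d+2} + (k+1)^{d+1} = (k+2)(k+1)^{d+1}
      have hNlt' : N < (k + 1) ^ (d + 2) + (k + 1) ^ (d + 1) := by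
        rw [pc_succ (k + 1) 0 (by omega), pc_zero_left, pc_zero_left,
          show d + 2 - 1 = d + 1 from rfl] at hNlt
        exact hNlt
      have hn₂Δ : n₂ ≤ (k + 1) ^ (d + 1) := by
        by_contra hc
        push Not at hc
        have : ((k + 1) ^ (d + 1) + 1) * (k + 1 + 1) ≤ n₂ * (k + 1 + 1) := Nat.mul_le_mul_right _ hc
        have e : ((k + 1) ^ (d + 1) + 1) * (k + 1 + 1) =
            (k + 1) ^ (d + 2) + (k + 1) ^ (d + 1) + (k + 2) := by ring
        omega
      -- apply P(d+1) with the pseudo-cubic Δ' = [k+1, 0]^{d+1}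
      have hP' := hP (k + 1) 0 (N - n₂ - pc k (d + 1) (d + 2)) n₂ (by omega) (by omega)
        (by rw [pc_zero_left]; omega) (by rw [pc_zero_left]; exact hn₂Δ) (by rw [pc_zero_left]; omega)
      rw [pc_zero_left, ← hΔ] at hP'
      rw [show N - n₂ - pc k (d + 1) (d + 2) + n₂ - pc k (d + 1) (d + 1) = n' by omega] at hP'
      omega
    · -- Case 2 with ℓ = t + 1 ≥ 1: Q = [m,t]^{d+2}, Δ' = [m,t]^{d+1}, (m+1) Δ' = [m,t+1]^{d+2}
      obtain ⟨t, rfl⟩ : ∃ t, ℓ = t + 1 := ⟨ℓ - 1, by omega⟩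
      have hQN : pc m t (d + 2) ≤ N - n₂ := by
        have := pc_pred_le_sub (d := d + 2) (by omega) hℓpos (by omega) (by omega) h2
        simpa using this
      have hQΔ : pc m t (d + 2) + pc m t (d + 1) = pc m (t + 1) (d + 2) := by
        rw [pc_succ m t (by omega), show d + 2 - 1 = d + 1 from rfl]
      have hmΔ : pc m t (d + 1) * (m + 1) = pc m (t + 1) (d + 2) := by
        unfold pc
        rw [show d + 2 - (t + 1) = d + 1 - t by omega, pow_succ]
        ring
      have hmΔ' : pc m t d * (m + 1) = pc m (t + 1) (d + 1) := by
        unfold pc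
        rw [show d + 1 - (t + 1) = d - t by omega, pow_succ]
        ring
      have h1 : cubicleCost (d + 2) (N - n₂) =
          boxPerim m t (d + 2) + cubicleCost (d + 1) (N - n₂ - pc m t (d + 2)) :=
        cubicleCost_eq (by omega) hm1 (by omega) hQN hcase
      have hbox : boxPerim m (t + 1) (d + 2) =
          boxPerim m t (d + 2) + cubicleCost (d + 1) (pc m t (d + 1)) := by
        rw [boxPerim_succ m t (by omega), show d + 2 - 1 = d + 1 from rfl,
          cubicleCost_pc (d := d + 1) (by omega) hm1 (by omega)]
      rw [hΦN, h1, hbox]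
      -- abbreviations
      have hn₁' : N - n₂ - pc m t (d + 2) + n₂ = pc m t (d + 1) + n' := by omega
      have hn₁'lt : N - n₂ - pc m t (d + 2) < pc m t (d + 1) := by omega
      by_cases h2a : n₂ ≤ pc m t (d + 1)
      · -- Sub-case 2a: P(d+1) with the pseudo-cubic Δ'
        have hP' := hP m t (N - n₂ - pc m t (d + 2)) n₂ hm1 (by omega) hn₁'lt.le h2a (by omega)
        rw [show N - n₂ - pc m t (d + 2) + n₂ - pc m t (d + 1) = n' by omega] at hP'
        omega
      · -- Sub-case 2b: n₂ = Δ' + n₂'' with 1 ≤ n₂'' and n₂'' (m+1) ≤ n'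
        push Not at h2a
        have hn₂''le : (n₂ - pc m t (d + 1)) * (m + 1) ≤ n' := by
          have e1 : n₂ * (m + 1) = pc m t (d + 1) * (m + 1) + (n₂ - pc m t (d + 1)) * (m + 1) := by
            rw [← Nat.add_mul, Nat.add_sub_cancel' h2a.le]
          omega
        have hm' : iroot (d + 1) n' ≤ m := iroot_le_of_lt_pc' (d := d + 1) (by omega) (by omega) hn'lt
        have hkey := hK n' (n₂ - pc m t (d + 1)) (Nat.sub_pos_of_lt h2a)
          (le_trans (Nat.mul_le_mul_left _ (by omega)) hn₂''le)
        rw [show d + 1 - 1 = d from rfl] at hkey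
        -- Φ_{d+1}(n₂) = Φ_{d+1}(Δ') + Φ_d(n₂'')  since n₂'' ≤ [m,t]^d
        have hn₂''lt : n₂ - pc m t (d + 1) ≤ pc m t d := by
          by_contra hc
          push Not at hc
          have : (pc m t d + 1) * (m + 1) ≤ (n₂ - pc m t (d + 1)) * (m + 1) :=
            Nat.mul_le_mul_right _ hc
          rw [Nat.add_mul, hmΔ', one_mul] at this
          omega
        have hΦn₂ : cubicleCost (d + 1) n₂ =
            cubicleCost (d + 1) (pc m t (d + 1)) + cubicleCost d (n₂ - pc m t (d + 1)) := by
          have := cubicleCost_pc_add (d := d + 1) (by omega) hm1 (show t ≤ d + 1 - 1 by omega) hn₂''lt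
          rw [Nat.add_sub_cancel' h2a.le, show d + 1 - 1 = d from rfl,
            ← cubicleCost_pc (d := d + 1) (by omega) hm1 (show t ≤ d + 1 - 1 by omega)] at this
          exact this
        rw [hΦn₂]
        rw [show N - n₂ - pc m t (d + 2) = n' - (n₂ - pc m t (d + 1)) by omega]
        omega

end Key

/-! ### [AL13] §5: the statement `P` in dimension `d + 2` from dimension `d + 1` -/

section PStep

variable {d : ℕ}

/-- Realizability of a box with a top layer in dimension `D` (true for the optimum by stacking `j`
copies of a nested minimizer of size `Δ` and one of size `x ≤ Δ`; for the cubicle cost it follows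
once `cubicleCost D = EIP^D`): `Φ_D(jΔ + x) ≤ 2Δ + j·Φ_{D−1}(Δ) + Φ_{D−1}(x)`.
[cite: AgnarssonLauria2013, §5 (proof of (1st-impl): "one can put n'' points on one side of the G(n₂,i)-box")] -/
def CubicleReal (D : ℕ) : Prop :=
  ∀ Δ j x : ℕ, 1 ≤ j → x ≤ Δ →
    cubicleCost D (j * Δ + x) ≤ 2 * Δ + j * cubicleCost (D - 1) Δ + cubicleCost (D - 1) x

/-- Monotonicity in the dimension (a `(D−1)`-dimensional set as one slice of `ℤ^D`):
`Φ_D(x) ≤ 2x + Φ_{D−1}(x)`. [cite: AgnarssonLauria2013, §5 (proof of (1st-impl): "E_{d−1}(n'') ≤ E_d(n'')")] -/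
def CubicleMono (D : ℕ) : Prop := ∀ x : ℕ, cubicleCost D x ≤ 2 * x + cubicleCost (D - 1) x

/-- Repeated subadditivity: `Φ(x + jΔ) ≤ Φ(x) + j Φ(Δ)`. [cite: AgnarssonLauria2013, §5 ("E_{d−1} is super-additive")] -/
theorem CubicleSubadd.add_mul_le {D : ℕ} (hS : CubicleSubadd D) (x Δ : ℕ) :
    ∀ j : ℕ, cubicleCost D (x + j * Δ) ≤ cubicleCost D x + j * cubicleCost D Δ
  | 0 => by simp
  | j + 1 => by
    have ih := CubicleSubadd.add_mul_le hS x Δ j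
    have h := hS (x + j * Δ) Δ
    rw [show x + (j + 1) * Δ = x + j * Δ + Δ by ring]
    calc cubicleCost D (x + j * Δ + Δ) ≤ cubicleCost D (x + j * Δ) + cubicleCost D Δ := h
      _ ≤ cubicleCost D x + j * cubicleCost D Δ + cubicleCost D Δ := Nat.add_le_add_right ih _
      _ = cubicleCost D x + (j + 1) * cubicleCost D Δ := by ring

/-- A pseudo-cubic `[m,ℓ]^D` with `ℓ ≤ D` has a valid representation `[m',ℓ']^D` with `ℓ' + 1 ≤ D`
(`[m,D]^D = [m+1,0]^D`). [cite: AgnarssonLauria2013, Definition 5.1 (remark (ii))] -/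
theorem exists_valid_pc {D m ℓ : ℕ} (hD : 1 ≤ D) (hm : 1 ≤ m) (hℓ : ℓ ≤ D) :
    ∃ m' ℓ', 1 ≤ m' ∧ ℓ' + 1 ≤ D ∧ pc m' ℓ' D = pc m ℓ D := by
  rcases hℓ.lt_or_eq with h | rfl
  · exact ⟨m, ℓ, hm, h, rfl⟩
  · exact ⟨m + 1, 0, by omega, by omega, by rw [pc_zero_left, pc_self]⟩

/-- The cubicle cost of a pseudo-cube `[m,ℓ]^D` (`ℓ ≤ D`, top case included) is its box perimeter.
[cite: AgnarssonLauria2013, eq. (F(pc)-exactl)] -/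
theorem cubicleCost_pc_of_le {D m ℓ : ℕ} (hD : 1 ≤ D) (hm : 1 ≤ m) (hℓ : ℓ ≤ D) :
    cubicleCost D (pc m ℓ D) = boxPerim m ℓ D := by
  rcases hℓ.lt_or_eq with h | rfl
  · exact cubicleCost_pc hD hm (by omega)
  · exact cubicleCost_pc_self hD m

/-- `n₂ ≤ n₁ < [m₁,ℓ₁+1]^{d+2}` forces `[m₂,ℓ₂]^{d+1} ≤ [m₁,ℓ₁]^{d+1}` for the leading terms: the slices
of the smaller number's pseudo-cube are not larger. [cite: AgnarssonLauria2013, Observation 5.4] -/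
theorem pdelta_le_of_le {n₁ n₂ : ℕ} (h : n₂ ≤ n₁) :
    pc (iroot (d + 2) n₂) (plead (d + 2) n₂) (d + 1) ≤
      pc (iroot (d + 2) n₁) (plead (d + 2) n₁) (d + 1) := by
  have hm₂ : iroot (d + 2) n₂ ≤ iroot (d + 2) n₁ := iroot_mono (by omega) h
  have hℓ₁ := plead_le (d + 2) n₁
  have hℓ₂ := plead_le (d + 2) n₂
  rcases hm₂.lt_or_eq with hlt | heq
  · exact pc_le_pc_of_lt _ hlt (by omega) _ (by omega)
  · rw [heq]
    refine pc_mono_right _ ?_ (by omega)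
    -- same base: ℓ₂ ≤ ℓ₁ since [m,ℓ₂]^{d+2} ≤ n₂ ≤ n₁ < [m,ℓ₁+1]^{d+2}
    by_contra hc
    push Not at hc
    have h1 := pc_plead_le (d := d + 2) (by omega) n₂
    have h2 := lt_pc_plead_succ (d := d + 2) (by omega) n₁
    rw [heq] at h1
    have h3 := pc_mono_right (iroot (d + 2) n₁) (show plead (d + 2) n₁ + 1 ≤ plead (d + 2) n₂ by omega)
      (by omega) (d := d + 2)
    omega

/-- **[AL13] statement `P'(d+2, ·)`** from `P(d+1)`, subadditivity in dimension `d+1`, and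
realizability/monotonicity in dimension `d+2`: for `1 ≤ n₂ ≤ n₁` with `n₁ + n₂ ≥ [n₁]_+`,
`Φ([n₁]_+) + Φ(n₁ + n₂ − [n₁]_+) ≤ Φ(n₁) + Φ(n₂)`. [cite: AgnarssonLauria2013, §5 (proof of the implication (1st-impl), statements P'(d,n))] -/
theorem cubicleP'_succ_succ (hS : CubicleSubadd (d + 1)) (hP : CubicleP (d + 1))
    (hR : CubicleReal (d + 2)) (hM : CubicleMono (d + 2)) {n₁ n₂ : ℕ} (hn₁ : 1 ≤ n₁)
    (h21 : n₂ ≤ n₁)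
    (hsum : pc (iroot (d + 2) n₁) (plead (d + 2) n₁ + 1) (d + 2) ≤ n₁ + n₂) :
    cubicleCost (d + 2) (pc (iroot (d + 2) n₁) (plead (d + 2) n₁ + 1) (d + 2)) +
        cubicleCost (d + 2) (n₁ + n₂ - pc (iroot (d + 2) n₁) (plead (d + 2) n₁ + 1) (d + 2)) ≤
      cubicleCost (d + 2) n₁ + cubicleCost (d + 2) n₂ := by
  have hΔ₂₁ := pdelta_le_of_le (d := d) (n₁ := n₁) (n₂ := n₂)
  -- name the PCR of n₁
  obtain ⟨m₁, hm₁⟩ : ∃ m, iroot (d + 2) n₁ = m := ⟨_, rfl⟩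
  obtain ⟨ℓ₁, hℓ₁⟩ : ∃ ℓ, plead (d + 2) n₁ = ℓ := ⟨_, rfl⟩
  obtain ⟨n₁', hn₁'⟩ : ∃ n', prem (d + 2) n₁ = n' := ⟨_, rfl⟩
  rw [hm₁, hℓ₁] at hsum hΔ₂₁ ⊢
  have hm₁1 : 1 ≤ m₁ := hm₁ ▸ iroot_pos (by omega) hn₁
  have hℓ₁le : ℓ₁ ≤ d + 1 := hℓ₁ ▸ plead_le (d + 2) n₁
  have hpc₁ : pc m₁ ℓ₁ (d + 2) + n₁' = n₁ := by
    have := pc_add_prem (d := d + 2) (by omega) n₁; rwa [hm₁, hℓ₁, hn₁'] at this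
  have hn₁'lt : n₁' < pc m₁ ℓ₁ (d + 1) := by
    have := prem_lt_pdelta (d := d + 2) (by omega) n₁
    rw [hn₁'] at this; unfold pdelta at this; rwa [hm₁, hℓ₁] at this
  have hsucc₁ : pc m₁ (ℓ₁ + 1) (d + 2) = pc m₁ ℓ₁ (d + 2) + pc m₁ ℓ₁ (d + 1) := by
    rw [pc_succ m₁ ℓ₁ (by omega), show d + 2 - 1 = d + 1 from rfl]
  have hn₁lt : n₁ < pc m₁ (ℓ₁ + 1) (d + 2) := by
    have := lt_pc_plead_succ (d := d + 2) (by omega) n₁; rwa [hm₁, hℓ₁] at this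
  have hΦn₁ : cubicleCost (d + 2) n₁ = boxPerim m₁ ℓ₁ (d + 2) + cubicleCost (d + 1) n₁' := by
    rw [cubicleCost_succ_succ d (by omega), hm₁, hℓ₁, hn₁']
  have hΦP : cubicleCost (d + 2) (pc m₁ (ℓ₁ + 1) (d + 2)) =
      boxPerim m₁ ℓ₁ (d + 2) + cubicleCost (d + 1) (pc m₁ ℓ₁ (d + 1)) := by
    have := cubicleCost_pc_succ (d := d + 2) (by omega) hm₁1 (show ℓ₁ ≤ d + 2 - 1 by omega)
    rwa [show d + 2 - 1 = d + 1 from rfl] at this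
  -- n₂ ≥ 1
  have hn₂ : 1 ≤ n₂ := by
    by_contra h0
    have : n₂ = 0 := by omega
    rw [this, add_zero] at hsum
    omega
  -- name the PCR of n₂
  obtain ⟨m₂, hm₂⟩ : ∃ m, iroot (d + 2) n₂ = m := ⟨_, rfl⟩
  obtain ⟨ℓ₂, hℓ₂⟩ : ∃ ℓ, plead (d + 2) n₂ = ℓ := ⟨_, rfl⟩
  obtain ⟨n₂', hn₂'⟩ : ∃ n', prem (d + 2) n₂ = n' := ⟨_, rfl⟩
  rw [hm₂, hℓ₂] at hΔ₂₁
  have hΔ₂₁' : pc m₂ ℓ₂ (d + 1) ≤ pc m₁ ℓ₁ (d + 1) := hΔ₂₁ h21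
  have hm₂1 : 1 ≤ m₂ := hm₂ ▸ iroot_pos (by omega) hn₂
  have hℓ₂le : ℓ₂ ≤ d + 1 := hℓ₂ ▸ plead_le (d + 2) n₂
  have hpc₂ : m₂ * pc m₂ ℓ₂ (d + 1) + n₂' = n₂ := by
    have := pc_add_prem (d := d + 2) (by omega) n₂
    rwa [hm₂, hℓ₂, hn₂', ← mul_pc m₂ ℓ₂ (by omega)] at this
  have hn₂'lt : n₂' < pc m₂ ℓ₂ (d + 1) := by
    have := prem_lt_pdelta (d := d + 2) (by omega) n₂
    rw [hn₂'] at this; unfold pdelta at this; rwa [hm₂, hℓ₂] at this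
  have hΦn₂ : cubicleCost (d + 2) n₂ =
      2 * pc m₂ ℓ₂ (d + 1) + m₂ * cubicleCost (d + 1) (pc m₂ ℓ₂ (d + 1)) + cubicleCost (d + 1) n₂' := by
    rw [cubicleCost_succ_succ d (by omega), hm₂, hℓ₂, hn₂', boxPerim_succ_dim m₂ ℓ₂ (by omega),
      cubicleCost_pc_of_le (by omega) hm₂1 hℓ₂le]
  -- abbreviations as plain variables
  set Δ₁ := pc m₁ ℓ₁ (d + 1) with hΔ₁
  set Δ₂ := pc m₂ ℓ₂ (d + 1) with hΔ₂
  set B₂ := cubicleCost (d + 1) Δ₂ with hB₂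
  -- the least `i` with `Δ₁ ≤ i Δ₂ + n₂' + n₁'`
  classical
  have hex : ∃ i, Δ₁ ≤ i * Δ₂ + n₂' + n₁' := ⟨m₂, by omega⟩
  obtain ⟨i, hi_spec, hi_min⟩ : ∃ i, Δ₁ ≤ i * Δ₂ + n₂' + n₁' ∧
      ∀ j, j < i → ¬ Δ₁ ≤ j * Δ₂ + n₂' + n₁' :=
    ⟨Nat.find hex, Nat.find_spec hex, fun j hj => Nat.find_min hex hj⟩
  have hi_le : i ≤ m₂ := by
    by_contra h
    exact hi_min m₂ (by omega) (by omega)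
  have hiΔm : i * Δ₂ ≤ m₂ * Δ₂ := Nat.mul_le_mul_right _ hi_le
  have hiBm : i * B₂ ≤ m₂ * B₂ := Nat.mul_le_mul_right _ hi_le
  have e3 : (m₂ - i) * Δ₂ = m₂ * Δ₂ - i * Δ₂ := Nat.sub_mul _ _ _
  have e4 : (m₂ - i) * B₂ = m₂ * B₂ - i * B₂ := Nat.sub_mul _ _ _
  -- n'' and its size
  have hn''lt : i * Δ₂ + n₂' + n₁' - Δ₁ < Δ₂ := by
    rcases Nat.eq_zero_or_pos i with h0 | hipos
    · rw [h0, zero_mul, zero_add]; omega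
    · have := hi_min (i - 1) (by omega)
      rw [Nat.sub_mul, one_mul] at this
      have hiΔ : Δ₂ ≤ i * Δ₂ := Nat.le_mul_of_pos_left Δ₂ hipos
      omega
  -- Step 1: `Φ(Δ₁) + Φ(n'') ≤ Φ(n₁') + Φ(n₂') + i B₂` in dimension d+1
  obtain ⟨m₁', ℓ₁', hm₁', hℓ₁', hpc₁'⟩ := exists_valid_pc (D := d + 1) (by omega) hm₁1 hℓ₁le
  have hstep1 : cubicleCost (d + 1) Δ₁ + cubicleCost (d + 1) (i * Δ₂ + n₂' + n₁' - Δ₁) ≤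
      cubicleCost (d + 1) n₁' + cubicleCost (d + 1) n₂' + i * B₂ := by
    rcases Nat.eq_zero_or_pos i with h0 | hipos
    · -- i = 0: P(d+1) with parts n₁', n₂' ≤ Δ₁
      have hP' := hP m₁' ℓ₁' n₁' n₂' hm₁' hℓ₁' (by rw [hpc₁']; exact hn₁'lt.le)
        (by rw [hpc₁']; exact le_trans hn₂'lt.le hΔ₂₁') (by rw [hpc₁']; rw [h0] at hi_spec; omega)
      rw [hpc₁', ← hΔ₁] at hP'
      rw [h0, zero_mul, zero_add, zero_mul, add_zero, show n₂' + n₁' - Δ₁ = n₁' + n₂' - Δ₁ by omega]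
      exact hP'
    · -- i ≥ 1: subadditivity then P(d+1) with parts (i−1)Δ₂ + n₂' + n₁' < Δ₁ and Δ₂ ≤ Δ₁
      have hiΔ : Δ₂ ≤ i * Δ₂ := Nat.le_mul_of_pos_left Δ₂ hipos
      have hiB : B₂ ≤ i * B₂ := Nat.le_mul_of_pos_left B₂ hipos
      have hlt : i * Δ₂ - Δ₂ + n₂' + n₁' < Δ₁ := by
        have := hi_min (i - 1) (by omega)
        rw [Nat.sub_mul, one_mul] at this
        omega
      have hsub := hS.add_mul_le (n₁' + n₂') Δ₂ (i - 1)
      rw [Nat.sub_mul, one_mul, Nat.sub_mul, one_mul, ← hB₂,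
        show n₁' + n₂' + (i * Δ₂ - Δ₂) = i * Δ₂ - Δ₂ + n₂' + n₁' by omega] at hsub
      have hsub2 := hS n₁' n₂'
      have hP' := hP m₁' ℓ₁' (i * Δ₂ - Δ₂ + n₂' + n₁') Δ₂ hm₁' hℓ₁' (by rw [hpc₁']; exact hlt.le)
        (by rw [hpc₁']; exact hΔ₂₁') (by rw [hpc₁']; omega)
      rw [hpc₁', ← hΔ₁, ← hB₂,
        show i * Δ₂ - Δ₂ + n₂' + n₁' + Δ₂ - Δ₁ = i * Δ₂ + n₂' + n₁' - Δ₁ by omega] at hP'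
      omega
  -- Step 2: realise `n' = (m₂ − i) Δ₂ + n''` in dimension d+2
  have hn'eq : n₁ + n₂ - pc m₁ (ℓ₁ + 1) (d + 2) = (m₂ - i) * Δ₂ + (i * Δ₂ + n₂' + n₁' - Δ₁) := by
    rw [e3]; omega
  have hstep2 : cubicleCost (d + 2) (n₁ + n₂ - pc m₁ (ℓ₁ + 1) (d + 2)) ≤
      2 * Δ₂ + (m₂ - i) * B₂ + cubicleCost (d + 1) (i * Δ₂ + n₂' + n₁' - Δ₁) := by
    rw [hn'eq]
    rcases Nat.eq_zero_or_pos (m₂ - i) with h0 | hpos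
    · rw [h0, zero_mul, zero_add, zero_mul, add_zero]
      have := hM (i * Δ₂ + n₂' + n₁' - Δ₁)
      rw [show d + 2 - 1 = d + 1 from rfl] at this
      omega
    · have := hR Δ₂ (m₂ - i) (i * Δ₂ + n₂' + n₁' - Δ₁) hpos hn''lt.le
      rw [show d + 2 - 1 = d + 1 from rfl, ← hB₂] at this
      exact this
  -- assemble
  rw [hΦP, hΦn₁, hΦn₂]
  rw [e4] at hstep2
  omega

/-- **[AL13] `P'(d+2) ⇒ P(d+2)`** (iterating `P'` up the chain of pseudo-cubics `[n₁]_+ < ⋯ ≤ C`):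
`CubicleP (d+2)` from `P(d+1)`, subadditivity in dimension `d+1`, and realizability/monotonicity in
dimension `d+2`. [cite: AgnarssonLauria2013, §5 (the equivalence P'(d,n) ⇔ P(d,n) and the implication (1st-impl))] -/
theorem cubicleP_succ_succ (d : ℕ) (hS : CubicleSubadd (d + 1)) (hP : CubicleP (d + 1))
    (hR : CubicleReal (d + 2)) (hM : CubicleMono (d + 2)) : CubicleP (d + 2) := by
  -- symmetric strengthening, by strong induction on `C − max(n₁,n₂)`
  suffices H : ∀ k m ℓ n₁ n₂ : ℕ, pc m ℓ (d + 2) - n₁ = k → n₂ ≤ n₁ → 1 ≤ m → ℓ + 1 ≤ d + 2 →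
      n₁ ≤ pc m ℓ (d + 2) → pc m ℓ (d + 2) ≤ n₁ + n₂ →
      cubicleCost (d + 2) (pc m ℓ (d + 2)) + cubicleCost (d + 2) (n₁ + n₂ - pc m ℓ (d + 2)) ≤
        cubicleCost (d + 2) n₁ + cubicleCost (d + 2) n₂ by
    intro m ℓ n₁ n₂ hm hℓ h1 h2 h12
    rcases le_total n₂ n₁ with h | h
    · exact H _ m ℓ n₁ n₂ rfl h hm hℓ h1 h12
    · have := H _ m ℓ n₂ n₁ rfl h hm hℓ h2 (by omega)
      rw [add_comm n₂ n₁] at this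
      omega
  intro k
  induction k using Nat.strong_induction_on with
  | _ k ih =>
    intro m ℓ n₁ n₂ hk h21 hm hℓ h1 h12
    rcases h1.lt_or_eq with hlt | heq
    · -- n₁ < C: one P' step to [n₁]_+ ≤ C, then induction
      have hn₁ : 1 ≤ n₁ := by
        by_contra h0
        have : n₁ = 0 := by omega
        subst this
        have : n₂ = 0 := by omega
        subst this
        have := pc_pos hm ℓ (d + 2)
        omega
      have hP₁le : pc (iroot (d + 2) n₁) (plead (d + 2) n₁) (d + 2) ≤ n₁ := pc_plead_le (by omega) n₁
      have hsucc_le : pc (iroot (d + 2) n₁) (plead (d + 2) n₁ + 1) (d + 2) ≤ pc m ℓ (d + 2) :=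
        pc_succ_le_of_lt (by have := plead_le (d + 2) n₁; omega) (by omega)
          (lt_of_le_of_lt hP₁le hlt)
      have hn₁lt : n₁ < pc (iroot (d + 2) n₁) (plead (d + 2) n₁ + 1) (d + 2) :=
        lt_pc_plead_succ (by omega) n₁
      have step := cubicleP'_succ_succ hS hP hR hM hn₁ h21 (le_trans hsucc_le h12)
      set P₁ := pc (iroot (d + 2) n₁) (plead (d + 2) n₁ + 1) (d + 2) with hP₁
      -- apply the induction hypothesis to the pair (P₁, n₁ + n₂ − P₁)
      have ih' := ih (pc m ℓ (d + 2) - P₁) (by omega) m ℓ P₁ (n₁ + n₂ - P₁) rfl (by omega) hm hℓ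
        hsucc_le (by omega)
      rw [show P₁ + (n₁ + n₂ - P₁) = n₁ + n₂ by omega] at ih'
      exact le_trans ih' step
    · -- n₁ = C
      rw [heq, Nat.add_sub_cancel_left]

end PStep
/-! ### Subadditivity of `EIP^{n+1}` (far-apart unions) -/

section Subadd

variable {d : ℕ}

/-- `Θ(A ∪ B) ⊆ Θ(A) ∪ Θ(B)`. [folklore] -/
private theorem boundaryPairs_union_subset (A B : Finset (Site d)) :
    boundaryPairs (A ∪ B) ⊆ boundaryPairs A ∪ boundaryPairs B := by
  intro t ht
  rw [mem_boundaryPairs, mem_union, mem_union, not_or] at ht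
  rw [mem_union, mem_boundaryPairs, mem_boundaryPairs]
  rcases ht.1 with h | h
  · exact Or.inl ⟨h, ht.2.1⟩
  · exact Or.inr ⟨h, ht.2.2⟩

/-- `#Θ(A ∪ B) ≤ #Θ(A) + #Θ(B)`. [folklore] -/
private theorem card_boundaryPairs_union_le (A B : Finset (Site d)) :
    #(boundaryPairs (A ∪ B)) ≤ #(boundaryPairs A) + #(boundaryPairs B) :=
  (card_le_card (boundaryPairs_union_subset A B)).trans (card_union_le _ _)

/-- **`EIP^{n+1}` is subadditive**: `EIP(a + b) ≤ EIP(a) + EIP(b)` — place two minimizers far apart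
(a translate of the second beyond the first along the first axis).
[cite: AgnarssonLauria2013, §5 (proof of P(d,C): "E_{d−1} is super-additive"), in boundary form] -/
theorem eipValue_add_le (n a b : ℕ) :
    eipValue (n + 1) (a + b) ≤ eipValue (n + 1) a + eipValue (n + 1) b := by
  classical
  obtain ⟨A, hA, hAa⟩ := exists_isEIPMinimizer_card_eq n a
  obtain ⟨B, hB, hBb⟩ := exists_isEIPMinimizer_card_eq n b
  set t : ℤ := ∑ x ∈ A, |x 0| + ∑ y ∈ B, |y 0| + 1 with ht
  set v : Site (n + 1) := fun _ => t with hv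
  set B' : Finset (Site (n + 1)) := B.image fun y => y + v with hB'
  have hdisj : Disjoint A B' := by
    rw [disjoint_left]
    intro x hxA hxB'
    rw [hB', mem_image] at hxB'
    obtain ⟨y, hy, hyx⟩ := hxB'
    have h1 : |x 0| ≤ ∑ x ∈ A, |x 0| :=
      single_le_sum (f := fun x : Site (n + 1) => |x 0|) (fun _ _ => abs_nonneg _) hxA
    have h2 : |y 0| ≤ ∑ y ∈ B, |y 0| :=
      single_le_sum (f := fun y : Site (n + 1) => |y 0|) (fun _ _ => abs_nonneg _) hy
    have h3 : x 0 = y 0 + t := by rw [← hyx]; rfl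
    have h4 := le_abs_self (x 0)
    have h5 := neg_abs_le (y 0)
    omega
  have hcard : #(A ∪ B') = a + b := by
    rw [card_union_of_disjoint hdisj, hAa, hB', card_image_of_injective _ (add_left_injective v), hBb]
  have h := eipValue_le (A ∪ B')
  rw [hcard] at h
  refine h.trans ((card_boundaryPairs_union_le A B').trans ?_)
  rw [hB', card_boundaryPairs_image_add_right, hA.card_boundaryPairs_eq hAa,
    hB.card_boundaryPairs_eq hBb]

end Subadd

/-! ### Realising block profiles and the cube bound -/

section Realize

variable {n : ℕ} {D : ℕ → Finset (Site n)}

/-- One slice: `EIP^{n+1}(x) ≤ 2x + EIP^n(x)` (a single `EIP^n` minimizer in a hyperplane).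
[cite: AgnarssonLauria2013, §5 (statement P', the term F(n₂') with one slice)] -/
theorem eipValue_succ_le_two_mul_add (hD : IsNestedMinimizerFamily D) (x : ℕ) :
    eipValue (n + 1) x ≤ 2 * x + eipValue n x := by
  have hanti : Antitone (fun k : ℕ => if k = 0 then x else 0) := by
    intro a b hab
    dsimp only
    split_ifs <;> omega
  have h := eipValue_succ_le_profileCost hD (T := 1) hanti (by simp)
  simpa [profileCost_def] using h

/-- A block of `j ≥ 1` equal slices of size `Δ` followed by one slice of size `x ≤ Δ`:
`EIP^{n+1}(jΔ + x) ≤ 2Δ + j·EIP^n(Δ) + EIP^n(x)`.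
[cite: AgnarssonLauria2013, §5 (proof of P(d,C), the configuration ∪_{i<j} D(Δ)+i e_d ∪ D(x)+j e_d)] -/
theorem eipValue_succ_mul_add_le (hD : IsNestedMinimizerFamily D) {Δ j x : ℕ} (hj : 1 ≤ j)
    (hx : x ≤ Δ) : eipValue (n + 1) (j * Δ + x) ≤ 2 * Δ + j * eipValue n Δ + eipValue n x := by
  set f : ℕ → ℕ := fun k => if k < j then Δ else if k = j then x else 0 with hf
  have hanti : Antitone f := by
    intro a b hab
    simp only [hf]
    split_ifs <;> omega
  have hT : f (j + 1) = 0 := by simp only [hf]; split_ifs <;> omega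
  have hfk : ∀ k ∈ range j, f k = Δ := fun k hk => by simp [hf, mem_range.1 hk]
  have hf0 : f 0 = Δ := hfk 0 (mem_range.2 (by omega))
  have hfj : f j = x := by simp [hf]
  have hsum : ∑ k ∈ range (j + 1), f k = j * Δ + x := by
    rw [sum_range_succ, sum_congr rfl hfk, sum_const, card_range, smul_eq_mul, hfj]
  have hfk' : ∀ k ∈ range j, eipValue n (f k) = eipValue n Δ := fun k hk => by rw [hfk k hk]
  have hcost : profileCost n f (j + 1) = 2 * Δ + j * eipValue n Δ + eipValue n x := by
    rw [profileCost_def, sum_range_succ, hf0, hfj, sum_congr rfl hfk', sum_const, card_range,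
      smul_eq_mul]
    ring
  have h := eipValue_succ_le_profileCost hD hanti hT
  rwa [hsum, hcost] at h

/-- **The cube bound** `2(n+1)m^n ≤ EIP^{n+1}(m^{n+1})` (`m ≥ 1`), from the sharp Loomis–Whitney
edge-isoperimetric inequality `2d #A^{(d−1)/d} ≤ #Θ_d(A)`.
[cite: AgnarssonLauria2013, Proposition 3.2 (equality for d-th powers); LoomisWhitney1949, Theorem 2] -/
theorem boxPerim_zero_le_eipValue_pow {m : ℕ} (hm : 1 ≤ m) (n : ℕ) :
    boxPerim m 0 (n + 1) ≤ eipValue (n + 1) (m ^ (n + 1)) := by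
  obtain ⟨A, hA, hAN⟩ := exists_isEIPMinimizer_card_eq n (m ^ (n + 1))
  have hne : A.Nonempty := by
    rw [← card_pos, hAN]; exact pow_pos hm _
  have h := two_mul_card_mul_rpow_le_card_boundaryPairs (by omega) A hne
  rw [hA.card_boundaryPairs_eq hAN, hAN] at h
  have hpow : ((m ^ (n + 1) : ℕ) : ℝ) ^ ((((n + 1 : ℕ) : ℝ) - 1) / ((n + 1 : ℕ) : ℝ)) =
      (m : ℝ) ^ n := by
    rw [Nat.cast_pow, ← Real.rpow_natCast (m : ℝ) (n + 1), ← Real.rpow_mul (Nat.cast_nonneg m)]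
    have hn1 : ((n + 1 : ℕ) : ℝ) ≠ 0 := by positivity
    have : ((n + 1 : ℕ) : ℝ) * ((((n + 1 : ℕ) : ℝ) - 1) / ((n + 1 : ℕ) : ℝ)) = (n : ℝ) := by
      field_simp
      push_cast
      ring
    rw [this, Real.rpow_natCast]
  rw [hpow] at h
  have h' : ((2 * ((n + 1) * m ^ n) : ℕ) : ℝ) ≤ (eipValue (n + 1) (m ^ (n + 1)) : ℝ) := by
    push_cast at h ⊢
    linarith
  rw [boxPerim_zero, Nat.add_sub_cancel]
  exact_mod_cast h'

end Realize

/-! ### The induction on the dimension ([AL13] Theorem 6.4) -/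

section Main

variable {n : ℕ} {D : ℕ → Finset (Site (n + 1))}

/-- `E = F` in dimension `n+1` makes `F_{n+1}` (= `cubicleCost (n+1)`) subadditive.
[cite: AgnarssonLauria2013, §5 ("E_{d−1} is super-additive")] -/
theorem cubicleSubadd_of_eq (hval : ∀ N, eipValue (n + 1) N = cubicleCost (n + 1) N) :
    CubicleSubadd (n + 1) := fun a b => by
  rw [← hval, ← hval, ← hval]; exact eipValue_add_le n a b

/-- **Upper bound** `EIP^{n+2}(N) ≤ 2δ_{n+2}(N)`: the stack of `(n+1)`-dimensional nested minimizers
with the cubicle profile `cubicleSlices (n+2) N` is an `N`-point set of that perimeter.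
[cite: AgnarssonLauria2013, Observation 5.12 / Theorem 6.4 (E_d(n) ≥ F_d(n), the cubicle ⟦n⟧^d)] -/
theorem eipValue_le_cubicleCost_succ (hD : IsNestedMinimizerFamily D)
    (hval : ∀ N, eipValue (n + 1) N = cubicleCost (n + 1) N) (N : ℕ) :
    eipValue (n + 1 + 1) N ≤ cubicleCost (n + 1 + 1) N := by
  rcases Nat.eq_zero_or_pos N with rfl | hN
  · rw [eipValue_zero_right, cubicleCost_zero]
  have h := eipValue_succ_le_profileCost hD (cubicleSlices_antitone (n + 1) N)
    (cubicleSlices_eq_zero_of_lt' (k := iroot (n + 1 + 1) N + 1) (lt_add_one _))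
  rw [sum_cubicleSlices, profileCost_def] at h
  simp_rw [hval] at h
  have hc := cubicleSlices_cost (n + 1) hN
  omega

/-- **Lower bound** `2δ_{n+2}(N) ≤ EIP^{n+2}(N)`, by strong induction on `N`: a cube `N = m^{n+2}` is
settled by the Loomis–Whitney bound; otherwise take a minimizer `A`, an axis `s` with at least
`m + 1` non-empty sections (`m = ⌊N^{1/(n+2)}⌋`, `m^{n+2} < N`) and its smallest non-empty section,
of size `k ≤ N/(m+1)`: removing it costs `EIP^{n+2}(N) ≥ EIP^{n+2}(N−k) + EIP^{n+1}(k)`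
(`IsEIPMinimizer.eipValue_sub_add_eipValue_le`, [AL13] Observation 6.1), and the key inequality
`2δ_{n+2}(N) ≤ 2δ_{n+2}(N−k) + 2δ_{n+1}(k)` ([AL13] Lemma 6.3, `CubicleKey`) closes the induction.
[cite: AgnarssonLauria2013, Theorem 6.4 (proof)] -/
theorem cubicleCost_le_eipValue_succ (hD : IsNestedMinimizerFamily D)
    (hval : ∀ N, eipValue (n + 1) N = cubicleCost (n + 1) N) (hKey : CubicleKey (n + 1 + 1))
    (N : ℕ) : cubicleCost (n + 1 + 1) N ≤ eipValue (n + 1 + 1) N := by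
  induction N using Nat.strong_induction_on with | _ N ih => ?_
  rcases Nat.eq_zero_or_pos N with rfl | hN
  · rw [eipValue_zero_right, cubicleCost_zero]
  have hd : 1 ≤ n + 1 + 1 := by omega
  obtain ⟨A, hA, hAN⟩ := exists_isEIPMinimizer_card_eq (n + 1) N
  obtain ⟨m, hm⟩ : ∃ m, iroot (n + 1 + 1) N = m := ⟨_, rfl⟩
  have hm1 : 1 ≤ m := hm ▸ iroot_pos hd hN
  have hmN : m ^ (n + 1 + 1) ≤ N := hm ▸ iroot_pow_le hd N
  rcases hmN.eq_or_lt with hcube | hlt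
  · -- `N = m^{n+2}` is a cube: Loomis–Whitney
    rw [← hcube, ← pc_zero_left, cubicleCost_pc hd hm1 (Nat.zero_le _), pc_zero_left]
    exact boxPerim_zero_le_eipValue_pow hm1 (n + 1)
  · obtain ⟨s, k, hne, hsmall⟩ := exists_latticeSection_card_mul_le A (m := m) (by rw [hAN]; exact hlt)
    have hcut := hA.eipValue_sub_add_eipValue_le hD s k
    have hpos : 1 ≤ #(latticeSection s k A) := card_pos.2 hne
    rw [hAN] at hcut hsmall
    obtain ⟨n₂, hn₂⟩ : ∃ n₂, #(latticeSection s k A) = n₂ := ⟨_, rfl⟩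
    rw [hn₂] at hcut hsmall hpos
    have hk := hKey N n₂ hpos (by rw [hm]; exact hsmall)
    simp only [Nat.add_sub_cancel] at hk
    have hih := ih (N - n₂) (by omega)
    have hv := hval n₂
    omega

/-- The `E = F` bootstrap: `CubicleMono (n+2)` from the one-slice realisation.
[cite: AgnarssonLauria2013, §5 (statement P')] -/
theorem cubicleMono_succ (hD : IsNestedMinimizerFamily D)
    (hval : ∀ N, eipValue (n + 1) N = cubicleCost (n + 1) N)
    (hval' : ∀ N, eipValue (n + 1 + 1) N = cubicleCost (n + 1 + 1) N) :
    CubicleMono (n + 1 + 1) := by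
  intro x
  have h := eipValue_succ_le_two_mul_add hD x
  rw [hval, hval'] at h
  simpa only [Nat.add_sub_cancel] using h

/-- The `E = F` bootstrap: `CubicleReal (n+2)` from the block realisation.
[cite: AgnarssonLauria2013, §5 (proof of P(d,C))] -/
theorem cubicleReal_succ (hD : IsNestedMinimizerFamily D)
    (hval : ∀ N, eipValue (n + 1) N = cubicleCost (n + 1) N)
    (hval' : ∀ N, eipValue (n + 1 + 1) N = cubicleCost (n + 1 + 1) N) :
    CubicleReal (n + 1 + 1) := by
  intro Δ j x hj hx
  have h := eipValue_succ_mul_add_le hD hj hx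
  rw [hval, hval, hval'] at h
  simpa only [Nat.add_sub_cancel] using h

/-- **Nested solutions in `ℤ^{n+2}`** from nested solutions in `ℤ^{n+1}` and `E = F` in both
dimensions: the stacks `famStack D (cubicleSlices (n+2) N) (⌊N^{1/(n+2)}⌋ + 1)` — the cubicles
`⟦N⟧^{n+2}` of [AL13] built over the given nested family — form a nested family of minimizers.
[cite: AgnarssonLauria2013, Proposition 5.7 (ii) with Theorem 6.4; MaininiSchmidt2020, Theorem 2.2] -/
theorem isNestedMinimizerFamily_cubicle_succ (hD : IsNestedMinimizerFamily D)
    (hval : ∀ N, eipValue (n + 1) N = cubicleCost (n + 1) N)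
    (hval' : ∀ N, eipValue (n + 1 + 1) N = cubicleCost (n + 1 + 1) N) :
    IsNestedMinimizerFamily
      (fun N => famStack D (cubicleSlices (n + 1 + 1) N) (iroot (n + 1 + 1) N + 1)) :=
  isNestedMinimizerFamily_famStack_of_chain hD (cubicleSlices (n + 1 + 1))
    (fun N => iroot (n + 1 + 1) N + 1) (cubicleSlices_antitone (n + 1))
    (fun _ _ hk => cubicleSlices_eq_zero_of_lt' hk) (sum_cubicleSlices (n + 1))
    (fun N => by
      rcases Nat.eq_zero_or_pos N with rfl | hN
      · simp [profileCost_def, eipValue_zero_right]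
      · have hc := cubicleSlices_cost (n + 1) hN
        rw [profileCost_def, hval']
        simp_rw [hval]
        omega)
    (cubicleSlices_mono (n + 1))

/-- Dimension one: `EIP^1(N) = 2δ_1(N)` (`= 2` for `N ≥ 1`). [cite: AgnarssonLauria2013, §5 (d = 1)] -/
theorem eipValue_one_eq_cubicleCost (N : ℕ) : eipValue 1 N = cubicleCost 1 N := by
  rcases Nat.eq_zero_or_pos N with rfl | hN
  · rw [eipValue_zero_right, cubicleCost_zero]
  · rw [eipValue_one hN, cubicleCost_one hN]

/-- **[AL13] Theorem 6.4 with nested solutions, by induction on the dimension `n + 1`**: `E = F`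
(`eipValue (n+1) = cubicleCost (n+1)`), nested `EIP^{n+1}` minimizers exist, and the arithmetic
statements `P(n+1, ·)` and Lemma 6.3 hold in dimension `n + 1`.
[cite: AgnarssonLauria2013, Theorem 6.4 (induction on d + n) and Proposition 5.7] -/
theorem eipValue_eq_cubicleCost_and_nested (n : ℕ) :
    (∀ N, eipValue (n + 1) N = cubicleCost (n + 1) N) ∧
      (∃ D : ℕ → Finset (Site (n + 1)), IsNestedMinimizerFamily D) ∧
      CubicleP (n + 1) ∧ CubicleKey (n + 1) := by
  induction n with
  | zero =>
    exact ⟨eipValue_one_eq_cubicleCost, ⟨intervalConfig, isNestedMinimizerFamily_intervalConfig⟩,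
      cubicleP_one, cubicleKey_one⟩
  | succ n ih =>
    obtain ⟨hval, ⟨D, hD⟩, hP, hK⟩ := ih
    have hS : CubicleSubadd (n + 1) := cubicleSubadd_of_eq hval
    have hKey : CubicleKey (n + 1 + 1) := cubicleKey_succ_succ n hS hP hK
    have hval' : ∀ N, eipValue (n + 1 + 1) N = cubicleCost (n + 1 + 1) N := fun N =>
      le_antisymm (eipValue_le_cubicleCost_succ hD hval N)
        (cubicleCost_le_eipValue_succ hD hval hKey N)
    exact ⟨hval', ⟨_, isNestedMinimizerFamily_cubicle_succ hD hval hval'⟩,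
      cubicleP_succ_succ n hS hP (cubicleReal_succ hD hval hval') (cubicleMono_succ hD hval hval'),
      hKey⟩

end Main

/-! ### Consequences in every dimension `d ≥ 1` -/

section Consequences

variable {d : ℕ}

/-- **[AL13] Theorem 6.4 (Ahlswede–Bezrukov / Bollobás–Leader) in boundary form**:
`EIP^d(N) = 2δ_d(N)` — the minimal edge perimeter of `N` points in `ℤ^d` is the perimeter of the
cubicle `⟦N⟧^d`, computed by the pseudo-cubic representation (`cubicleCost`). Equivalently, by
`#Θ = 2dN − 2·#(induced edges)`, `max #edges = F_d(N) = Σ_i (d+1−i) g_i(N)`.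
[cite: AgnarssonLauria2013, Theorem 6.4] -/
theorem eipValue_eq_cubicleCost (hd : 1 ≤ d) (N : ℕ) : eipValue d N = cubicleCost d N := by
  obtain ⟨n, rfl⟩ : ∃ n, d = n + 1 := ⟨d - 1, by omega⟩
  exact (eipValue_eq_cubicleCost_and_nested n).1 N

/-- A finite `C ⊂ ℤ^d` (`d ≥ 1`) is an `EIP^d` minimizer iff `#Θ_d(C) = cubicleCost d #C` — a
decidable criterion. [cite: AgnarssonLauria2013, Theorem 6.4] -/
theorem isEIPMinimizer_iff_card_boundaryPairs_eq_cubicleCost (hd : 1 ≤ d) {C : Finset (Site d)} :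
    IsEIPMinimizer C ↔ #(boundaryPairs C) = cubicleCost d #C := by
  rw [isEIPMinimizer_iff_eipValue, eipValue_eq_cubicleCost hd]

/-- **Nested solutions of the edge-isoperimetric problem in `ℤ^d`, every `d ≥ 1`** (Ahlswede–Bezrukov
1995; Harper; = [MS20] Theorem 2.2 in the order form): there is a family `D : ℕ → Finset (ℤ^d)` with
`#D(N) = N`, `D(N) ⊆ D(N+1)` and every `D(N)` an `EIP^d` minimizer.
[cite: MaininiSchmidt2020, Theorem 2.2; AgnarssonLauria2013, Theorem 6.4 with Proposition 5.7 (ii)] -/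
theorem exists_isNestedMinimizerFamily (hd : 1 ≤ d) :
    ∃ D : ℕ → Finset (Site d), IsNestedMinimizerFamily D := by
  obtain ⟨n, rfl⟩ : ∃ n, d = n + 1 := ⟨d - 1, by omega⟩
  exact (eipValue_eq_cubicleCost_and_nested n).2.1

/-- `EIP^d` is subadditive for every `d ≥ 1`. [cite: AgnarssonLauria2013, §5] -/
theorem eipValue_add_le' (hd : 1 ≤ d) (a b : ℕ) : eipValue d (a + b) ≤ eipValue d a + eipValue d b := by
  obtain ⟨n, rfl⟩ : ∃ n, d = n + 1 := ⟨d - 1, by omega⟩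
  exact eipValue_add_le n a b

/-- [AL13] statement `P(d, ·)` holds in every dimension (vacuous for `d = 0`).
[cite: AgnarssonLauria2013, Lemma 5.9] -/
theorem cubicleP_all (d : ℕ) : CubicleP d := by
  rcases d with _ | n
  · intro m ℓ n₁ n₂ _ _ _ _ _; simp
  · exact (eipValue_eq_cubicleCost_and_nested n).2.2.1

/-- `CubicleP` holds for all parameters — `_holds` alias of `cubicleP_all` above under the fact's exact name
(appended 2026-08-28, D-0026 bookkeeping: the proof term is the existing theorem of this file; no statement,
definition or attribute is edited; no new named fact; the ledger's debt table listed the fact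
unproved). [cite: AgnarssonLauria2013, Lemma 5.9] -/
theorem _root_.Literature.MathematicalPhysics.StatisticalMechanics.CubicleP_holds (d : ℕ) :
    CubicleP d :=
  _root_.Literature.MathematicalPhysics.StatisticalMechanics.cubicleP_all d

/-- [AL13] Lemma 6.3 (the key inequality) holds in every dimension (vacuous for `d = 0`).
[cite: AgnarssonLauria2013, Lemma 6.3] -/
theorem cubicleKey_all (d : ℕ) : CubicleKey d := by
  rcases d with _ | n
  · intro N n₂ _ _; simp
  · exact (eipValue_eq_cubicleCost_and_nested n).2.2.2

/-- `CubicleKey` holds for all parameters — `_holds` alias of `cubicleKey_all` above under the fact's exact name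
(appended 2026-08-28, D-0026 bookkeeping: the proof term is the existing theorem of this file; no statement,
definition or attribute is edited; no new named fact; the ledger's debt table listed the fact
unproved). [cite: AgnarssonLauria2013, Lemma 6.3] -/
theorem _root_.Literature.MathematicalPhysics.StatisticalMechanics.CubicleKey_holds (d : ℕ) :
    CubicleKey d :=
  _root_.Literature.MathematicalPhysics.StatisticalMechanics.cubicleKey_all d

/-- `cubicleCost d` is subadditive in every dimension. [cite: AgnarssonLauria2013, §5] -/
theorem cubicleSubadd_all (d : ℕ) : CubicleSubadd d := by
  rcases d with _ | n
  · intro a b; simp [cubicleCost_dim_zero]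
  · exact cubicleSubadd_of_eq (eipValue_eq_cubicleCost_and_nested n).1

/-- `CubicleSubadd` holds for all parameters — `_holds` alias of `cubicleSubadd_all` above under the fact's exact name
(appended 2026-08-28, D-0026 bookkeeping: the proof term is the existing theorem of this file; no statement,
definition or attribute is edited; no new named fact; the ledger's debt table listed the fact
unproved). [cite: AgnarssonLauria2013, §5] -/
theorem _root_.Literature.MathematicalPhysics.StatisticalMechanics.CubicleSubadd_holds (d : ℕ) :
    CubicleSubadd d :=
  _root_.Literature.MathematicalPhysics.StatisticalMechanics.cubicleSubadd_all d

/-- `CubicleMono d` in every dimension. [cite: AgnarssonLauria2013, §5 (statement P')] -/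
theorem cubicleMono_all (d : ℕ) : CubicleMono d := by
  rcases d with _ | _ | n
  · intro x; simp
  · intro x
    simp only [Nat.sub_self, cubicleCost_dim_zero, add_zero]
    rcases Nat.eq_zero_or_pos x with rfl | hx
    · simp
    · rw [cubicleCost_one hx]; omega
  · obtain ⟨hval, ⟨D, hD⟩, -, -⟩ := eipValue_eq_cubicleCost_and_nested n
    exact cubicleMono_succ hD hval (eipValue_eq_cubicleCost_and_nested (n + 1)).1

/-- `CubicleReal d` in every dimension. [cite: AgnarssonLauria2013, §5 (proof of P(d,C))] -/
theorem cubicleReal_all (d : ℕ) : CubicleReal d := by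
  rcases d with _ | _ | n
  · intro Δ j x _ _; simp
  · intro Δ j x hj hx
    simp only [Nat.sub_self, cubicleCost_dim_zero, mul_zero, add_zero]
    rcases Nat.eq_zero_or_pos Δ with rfl | hΔ
    · obtain rfl : x = 0 := by omega
      simp
    · rw [cubicleCost_one
        (le_trans (le_trans hΔ (Nat.le_mul_of_pos_left Δ hj)) (Nat.le_add_right _ _))]
      omega
  · obtain ⟨hval, ⟨D, hD⟩, -, -⟩ := eipValue_eq_cubicleCost_and_nested n
    exact cubicleReal_succ hD hval (eipValue_eq_cubicleCost_and_nested (n + 1)).1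

/-- **Mainini–Schmidt 2020, Corollary 3.3, DISCHARGED** (`MaininiSchmidt2020_cor33_holds`): every
axis-parallel section of an `EIP^{n+1}` minimizer is an `EIP^n` minimizer — from nested solutions in
every `ℤ^n` (`exists_isNestedMinimizerFamily`) through the section-rearrangement inequality
(`MaininiSchmidt2020_cor33_of_nested'`, [MS20] Proposition 3.2).
[cite: MaininiSchmidt2020, Corollary 3.3 (via Theorem 2.2 and Proposition 3.2)] -/
theorem MaininiSchmidt2020_cor33_holds : MaininiSchmidt2020_cor33 :=
  MaininiSchmidt2020_cor33_of_nested' fun _ hn => exists_isNestedMinimizerFamily hn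

end Consequences

end Literature.MathematicalPhysics.StatisticalMechanics
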